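import Summits.KontsevichZagierPeriods.KontsevichZagierPeriods.Theorems.XMapKernel.Negative.Core

/-!
# `XMapKernel` (stmt-KontsevichZagierPeriods-10663), negative side: Newton–Leibniz is needed at EVERY level

Sharpening of `false_without_newtonLeibniz` (`Negative/Core.lean`): for every `N : ℕ`, the crux
`XMapKernel` becomes FALSE if the Newton–Leibniz move (rule 3 of [Kontsevich–Zagier 2001, §1.2]) is
allowed only between dimensions `(n+1, n)` with `n ≠ N` — i.e. no generating set that omits the
Newton–Leibniz instances of one single level `(N+1 → N)` generates `ker eval`, even together with
rules (1a), (1b), (2), all other levels of rule (3) and the x-map relators. The invariant is the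
truncated evaluation `truncEval N` (evaluate only generators of dimension `≤ N`): rules (1a), (1b),
(2) and the x-map relators preserve the dimension and are sound; a Newton–Leibniz instance of level
`n ≠ N` either lives in dimensions `≤ N` (sound) or in dimensions `> N` (invisible); but the unit slab
tower `[pt,1]·[0,1]^{N+1} − [pt,1]·[0,1]^{N}` (one level-`N` instance, value `1 − 1 = 0`) has
`truncEval N = −1`. So a proof of the crux cannot confine rule (3) to a bounded — or co-bounded — range
of dimensions.

Sources: M. Kontsevich, D. Zagier, *Periods* (2001), §1.2 rule 3). -/

noncomputable section

namespace Summit.KontsevichZagierPeriods.XMapKernel.Negative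

open Literature.NumberTheory.Transcendental
open Summit.KontsevichZagierPeriods.KontsevichZagierPeriods.Theses.IsogenyCertificates
open Set MeasureTheory

/-! ### Newton–Leibniz instances away from one level -/

/-- The Newton–Leibniz move (rule 3, verbatim from `KZ.newtonLeibnizRel`) restricted to instances
between dimensions `n + 1` and `n` with `n ≠ N`. [cite: KontsevichZagier2001, §1.2 rule (3)] -/
def newtonLeibnizRelExcept (N : ℕ) : Set KZ.FormalRep :=
  {c | ∃ (n : ℕ) (r : KZ.IntegralRep (n + 1)) (r' : KZ.IntegralRep n) (a b : (Fin n → ℝ) → ℝ)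
      (F : (Fin (n + 1) → ℝ) → ℝ), n ≠ N ∧
    IsSemialgebraicFunOn ℚ r.domain F ∧
    IsSemialgebraicFunOn ℚ r'.domain a ∧ IsSemialgebraicFunOn ℚ r'.domain b ∧
    (∀ x ∈ r'.domain, a x ≤ b x) ∧
    r.domain = {z | (Fin.init z : Fin n → ℝ) ∈ r'.domain ∧ a (Fin.init z) ≤ z (Fin.last n) ∧
      z (Fin.last n) ≤ b (Fin.init z)} ∧
    (∀ x ∈ r'.domain, ContinuousOn (fun t : ℝ => F (Fin.snoc x t)) (Icc (a x) (b x))) ∧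
    (∀ x ∈ r'.domain, ∀ t ∈ Ioo (a x) (b x),
      HasDerivAt (fun s : ℝ => F (Fin.snoc x s)) (r.integrand (Fin.snoc x t)) t) ∧
    (∀ x ∈ r'.domain, r'.integrand x = F (Fin.snoc x (b x)) - F (Fin.snoc x (a x))) ∧
    c = KZ.of r - KZ.of r'}

/-- These are Newton–Leibniz instances. [cite: KontsevichZagier2001, §1.2 rule (3)] -/
theorem newtonLeibnizRelExcept_subset (N : ℕ) : newtonLeibnizRelExcept N ⊆ KZ.newtonLeibnizRel := by
  rintro c ⟨n, r, r', a, b, F, -, h1, h2, h3, h4, h5, h6, h7, h8, h9⟩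
  exact ⟨n, r, r', a, b, F, h1, h2, h3, h4, h5, h6, h7, h8, h9⟩

/-! ### The truncated evaluation -/

/-- Projection of a formal combination onto its generators of dimension `≤ N`. [folklore] -/
def truncPart (N : ℕ) : KZ.FormalRep →+ KZ.FormalRep :=
  FreeAbelianGroup.lift fun p => if p.1 ≤ N then FreeAbelianGroup.of p else 0

/-- `truncPart N [r] = [r]` in dimension `≤ N`, `= 0` above. [folklore] -/
@[simp] theorem truncPart_of (N : ℕ) {n : ℕ} (r : KZ.IntegralRep n) :
    truncPart N (KZ.of r) = if n ≤ N then KZ.of r else 0 := by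
  simp [truncPart, KZ.of]

/-- **The truncated evaluation**: evaluate only the generators of dimension `≤ N`. [folklore] -/
def truncEval (N : ℕ) : KZ.FormalRep →+ ℝ := KZ.eval.comp (truncPart N)

/-- `truncEval N [r] = value r` in dimension `≤ N`, `= 0` above. [folklore] -/
@[simp] theorem truncEval_of (N : ℕ) {n : ℕ} (r : KZ.IntegralRep n) :
    truncEval N (KZ.of r) = if n ≤ N then r.value else 0 := by
  simp only [truncEval, AddMonoidHom.coe_comp, Function.comp_apply, truncPart_of]
  split_ifs <;> simp

/-- Rule (1a) preserves `truncEval N`. [cite: KontsevichZagier2001, §1.2 rule (1)] -/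
theorem truncEval_eq_zero_of_mem_domainAddRel (N : ℕ) {c : KZ.FormalRep} (hc : c ∈ KZ.domainAddRel) :
    truncEval N c = 0 := by
  have h0 : KZ.eval c = 0 := KZ.eval_eq_zero_of_mem_domainAddRel_holds hc
  obtain ⟨n, r, r₁, r₂, -, -, -, -, rfl⟩ := hc
  by_cases hn : n ≤ N
  · simpa [map_sub, hn] using h0
  · simp [map_sub, hn]

/-- Rule (1b) preserves `truncEval N`. [cite: KontsevichZagier2001, §1.2 rule (1)] -/
theorem truncEval_eq_zero_of_mem_integrandAddRel (N : ℕ) {c : KZ.FormalRep} (hc : c ∈ KZ.integrandAddRel) :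
    truncEval N c = 0 := by
  have h0 : KZ.eval c = 0 := KZ.eval_eq_zero_of_mem_integrandAddRel_holds hc
  obtain ⟨n, r, r₁, r₂, -, -, -, rfl⟩ := hc
  by_cases hn : n ≤ N
  · simpa [map_sub, hn] using h0
  · simp [map_sub, hn]

/-- Rule (2) preserves `truncEval N`. [cite: KontsevichZagier2001, §1.2 rule (2)] -/
theorem truncEval_eq_zero_of_mem_changeOfVariablesRel (N : ℕ) {c : KZ.FormalRep}
    (hc : c ∈ KZ.changeOfVariablesRel) : truncEval N c = 0 := by
  have h0 : KZ.eval c = 0 := KZ.eval_eq_zero_of_mem_changeOfVariablesRel_holds hc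
  obtain ⟨n, r, r', Φ, Φ', -, -, -, -, -, rfl⟩ := hc
  by_cases hn : n ≤ N
  · simpa [map_sub, hn] using h0
  · simp [map_sub, hn]

/-- The x-map relators (dimension `1`, equal values) are killed by `truncEval N`. [folklore] -/
theorem truncEval_eq_zero_of_mem_xMapRel (N : ℕ) {c : KZ.FormalRep} (hc : c ∈ xMapRel) :
    truncEval N c = 0 := by
  obtain ⟨A, B, A', B', f, g, c, a, b, r, r', -, -, -, -, -, -, -, -, -, -, hv, rfl⟩ := hc
  by_cases h1 : 1 ≤ N
  · simp [map_sub, h1, hv]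
  · simp [map_sub, h1]

/-- A Newton–Leibniz instance of level `n ≠ N` is killed by `truncEval N`: for `n < N` it lives in
dimensions `≤ N` where `truncEval N` is `eval` (sound), for `n > N` both generators are invisible.
[cite: KontsevichZagier2001, §1.2 rule (3)] -/
theorem truncEval_eq_zero_of_mem_newtonLeibnizRelExcept (N : ℕ) {c : KZ.FormalRep}
    (hc : c ∈ newtonLeibnizRelExcept N) : truncEval N c = 0 := by
  have h0 : KZ.eval c = 0 := KZ.eval_eq_zero_of_mem_newtonLeibnizRel_holds (newtonLeibnizRelExcept_subset N hc)
  obtain ⟨n, r, r', a, b, F, hn, -, -, -, -, -, -, -, -, rfl⟩ := hc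
  rcases lt_or_gt_of_ne hn with hlt | hgt
  · have h1 : n + 1 ≤ N := hlt
    have h2 : n ≤ N := hlt.le
    simpa [map_sub, h1, h2] using h0
  · have h1 : ¬ n + 1 ≤ N := by omega
    have h2 : ¬ n ≤ N := by omega
    simp [map_sub, h1, h2]

/-- Generators with rule (3) confined away from level `N`. [folklore] -/
def gensExceptLevel (N : ℕ) : Set KZ.FormalRep := gensWithoutNL ∪ newtonLeibnizRelExcept N

/-- `closure (gensExceptLevel N) ≤ ker (truncEval N)`. [folklore] -/
theorem closure_gensExceptLevel_le_ker (N : ℕ) :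
    AddSubgroup.closure (gensExceptLevel N) ≤ (truncEval N).ker := by
  rw [AddSubgroup.closure_le]
  rintro d ((((hd | hd) | hd) | hd) | hd)
  · exact truncEval_eq_zero_of_mem_domainAddRel N hd
  · exact truncEval_eq_zero_of_mem_integrandAddRel N hd
  · exact truncEval_eq_zero_of_mem_changeOfVariablesRel N hd
  · exact truncEval_eq_zero_of_mem_xMapRel N hd
  · exact truncEval_eq_zero_of_mem_newtonLeibnizRelExcept N hd

/-! ### The unit slab tower -/

/-- `[pt,1]·[0,1]^N`: the `N`-fold unit slab over the unit representation (dimension `N`, domain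
`[0,1]^N`, integrand `1`). [folklore] -/
def unitTower : (N : ℕ) → KZ.IntegralRep N
  | 0 => KZ.IntegralRep.unit
  | N + 1 => (unitTower N).slab 0

/-- Each storey is ONE Newton–Leibniz move of level `N`. [cite: KontsevichZagier2001, §1.2 rule (3)] -/
theorem of_unitTower_succ_sub_mem (N : ℕ) :
    KZ.of (unitTower (N + 1)) - KZ.of (unitTower N) ∈ KZ.newtonLeibnizRel :=
  KZ.IntegralRep.of_slab_sub_of_mem_newtonLeibnizRel _ 0

/-- Every storey has value `1`. [folklore] -/
theorem value_unitTower : ∀ N : ℕ, (unitTower N).value = 1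
  | 0 => KZ.IntegralRep.value_unit
  | N + 1 => by
    have h := KZ.eval_eq_zero_of_mem_newtonLeibnizRel_holds (of_unitTower_succ_sub_mem N)
    rw [map_sub, KZ.eval_of, KZ.eval_of, sub_eq_zero] at h
    exact h.trans (value_unitTower N)

/-- The level-`N` witness `[pt,1]·[0,1]^{N+1} − [pt,1]·[0,1]^N`. [folklore] -/
def towerWitness (N : ℕ) : KZ.FormalRep := KZ.of (unitTower (N + 1)) - KZ.of (unitTower N)

/-- `eval (towerWitness N) = 0`. [folklore] -/
theorem eval_towerWitness (N : ℕ) : KZ.eval (towerWitness N) = 0 :=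
  KZ.eval_eq_zero_of_mem_newtonLeibnizRel_holds (of_unitTower_succ_sub_mem N)

/-- `truncEval N (towerWitness N) = −1`. [folklore] -/
theorem truncEval_towerWitness (N : ℕ) : truncEval N (towerWitness N) = -1 := by
  simp [towerWitness, map_sub, value_unitTower]

/-- `towerWitness N ∉ closure (gensExceptLevel N)`. [folklore] -/
theorem towerWitness_not_mem_closure (N : ℕ) : towerWitness N ∉ AddSubgroup.closure (gensExceptLevel N) := by
  intro h
  have := closure_gensExceptLevel_le_ker N h
  rw [AddMonoidHom.mem_ker, truncEval_towerWitness] at this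
  norm_num at this

/-- **Newton–Leibniz is needed at every level.** For every `N`, the crux with rule (3) confined to
levels `≠ N` (all other moves and the x-map relators kept) is false. [folklore] -/
theorem false_without_newtonLeibniz_level (N : ℕ) :
    ¬ (∀ c : KZ.FormalRep, KZ.eval c = 0 → c ∈ AddSubgroup.closure (gensExceptLevel N)) := fun h =>
  towerWitness_not_mem_closure N (h _ (eval_towerWitness N))

end Summit.KontsevichZagierPeriods.XMapKernel.Negative
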